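import Literature.AlgebraicGeometry.Motives.Jacobian
import HarnessLib

/-!
# The Jacobian of a curve: proofs towards `isIso_bettiCohomology_map_abelJacobi`

Companion file of `Literature/AlgebraicGeometry/Motives/Jacobian.lean`, collecting PROVED steps of
the named fact `Literature.AlgebraicGeometry.Motives.isIso_bettiCohomology_map_abelJacobi`
(`(f^P)^* : H¹(J(ℂ); ℚ) ≅ H¹(C(ℂ); ℚ)`, Lange, *Abelian Varieties over the Complex Numbers* (2023),
§4.1.1 and proof of Lemma 4.4.1; Milne, *Jacobian Varieties*, Thm. 2.5).

## Independence of the model of the Jacobian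

The published proof computes `H₁` of ONE model of the Jacobian — the analytic
`J(C) = H⁰(ω_C)^∨ / H₁(C, ℤ)` with its Abel–Jacobi map `α_c` (Lange §4.1.1: `α_{c*} : H₁(C, ℤ) →
H₁(J, ℤ)` is an isomorphism and `α_c^*` is its transpose, proof of Lemma 4.4.1), identified with
the algebraic Jacobian by Milne Thm. 2.5 — and every other pair `(J', f'^P)` with the universal
property is isomorphic to it by a unique isomorphism carrying `f^P` to `f'^P` (Milne, Remark 6.5;
in the tree `Jacobian.uniqueUpToIso`, `Jacobian.pushforward_id_eq_uniqueUpToIso_hom`). This file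
proves that last transfer step for the tree's abstract `Jacobian C`:

* `AbelianVariety.isIso_hom_hom_hom`: an isomorphism of abelian varieties is an isomorphism of the
  underlying `k`-schemes;
* `bettiCohomology.isIso_map`: Betti cohomology takes isomorphisms to isomorphisms;
* `Jacobian.bettiCohomology_map_pushforward_id_comp`: `(N_𝟙)^* ∘ (f^P_{𝒥₁})^* = (f^P_{𝒥₂})^*`;
* `Jacobian.isIso_bettiCohomology_map_abelJacobi_iff`: for two Jacobians `𝒥₁, 𝒥₂` of `C`,
  `(f^P_{𝒥₁})^*` is an isomorphism on `Hⁱ` iff `(f^P_{𝒥₂})^*` is;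
* `Jacobian.isIso_bettiCohomology_map_abelJacobi_jacobian`: transfer to the chosen `jacobian C h`.

What remains for the named fact itself is the computation for one model (abelian integrals,
Abel's theorem and Jacobi inversion, the complex-torus structure of `J(ℂ)`), none of which is in
the tree yet.

## References

* J. S. Milne, *Jacobian Varieties*, Ch. VII of Cornell–Silverman, *Arithmetic Geometry* (1986),
  §2 Thm. 2.5, §6 Remark 6.5. [Milne1986JacobianVarieties]
* H. Lange, *Abelian Varieties over the Complex Numbers*, Grundlehren Text Editions (2023), §4.1.1,
  Lemma 4.4.1 (proof). [Lange2023AbelianVarietiesC]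
-/

universe u

open CategoryTheory AlgebraicGeometry

noncomputable section

namespace Literature.AlgebraicGeometry.Motives

variable {k : Type u} [Field k]

/-- The morphism of `k`-schemes underlying an isomorphism of abelian varieties is an isomorphism
(the forgetful functor `AbelianVariety k ⥤ SchemeOver k` preserves isomorphisms). [folklore] -/
theorem AbelianVariety.isIso_hom_hom_hom {A B : AbelianVariety k} (ψ : A ⟶ B) [IsIso ψ] :
    IsIso ψ.hom.hom.hom :=
  ⟨⟨(inv ψ).hom.hom.hom, by
    change (ψ ≫ inv ψ).hom.hom.hom = (𝟙 A : A ⟶ A).hom.hom.hom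
    rw [IsIso.hom_inv_id], by
    change (inv ψ ≫ ψ).hom.hom.hom = (𝟙 B : B ⟶ B).hom.hom.hom
    rw [IsIso.inv_hom_id]⟩⟩

/-- Betti cohomology takes isomorphisms of `k`-schemes to isomorphisms (functoriality,
`bettiFunctor`). [folklore] -/
theorem bettiCohomology.isIso_map {k : Type} [Field k] [Algebra k ℂ] {X Y : SchemeOver k}
    (f : X ⟶ Y) [IsIso f] (i : ℕ) : IsIso (bettiCohomology.map f i) := by
  change IsIso ((bettiFunctor k i).map f.op)
  infer_instance

namespace Jacobian

/-- For two Jacobians `𝒥₁`, `𝒥₂` of the same curve, the comparison maps in Betti cohomology differ by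
the isomorphism induced by `uniqueUpToIso`: `(N_𝟙)^* ∘ (f^P_{𝒥₁})^* = (f^P_{𝒥₂})^*` with
`N_𝟙 : 𝒥₁.J ≅ 𝒥₂.J` (Milne, Remark 6.5: the pairs `(J, f^P)` are characterized up to a unique
isomorphism; `Jacobian.bettiCohomology_map_pushforward_comp` at `f = 𝟙 C`). [cite: Milne1986JacobianVarieties, §6 Remark 6.5] -/
theorem bettiCohomology_map_pushforward_id_comp {k : Type} [Field k] [Algebra k ℂ]
    {C : SchemeOver k} (𝒥₁ 𝒥₂ : Jacobian C) (P : AlgPoints C k) (i : ℕ) :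
    bettiCohomology.map (𝒥₁.pushforward 𝒥₂ (𝟙 C)).hom.hom.hom i ≫
        bettiCohomology.map (𝒥₁.abelJacobi P) i =
      bettiCohomology.map (𝒥₂.abelJacobi P) i := by
  have h := bettiCohomology_map_pushforward_comp 𝒥₁ 𝒥₂ (𝟙 C) P i
  rwa [Category.comp_id, bettiCohomology.map_id, Category.comp_id] at h

/-- **Independence of the model of the Jacobian.** For two Jacobians `𝒥₁`, `𝒥₂` of the same curve
`C` and a rational point `P`, `(f^P)^* : Hⁱ(J₁(ℂ); ℚ) → Hⁱ(C(ℂ); ℚ)` is an isomorphism iff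
`(f^P)^* : Hⁱ(J₂(ℂ); ℚ) → Hⁱ(C(ℂ); ℚ)` is: the two differ by the isomorphism `(N_𝟙)^*` induced by
the canonical `𝒥₁.J ≅ 𝒥₂.J` (Milne, Remark 6.5). This reduces the named fact
`isIso_bettiCohomology_map_abelJacobi` to any single construction of the Jacobian, as announced in
its docstring ("every `Jacobian C` is the algebraic one up to an isomorphism carrying `f^P` to
`f^P`"). [cite: Milne1986JacobianVarieties, §6 Remark 6.5] -/
theorem isIso_bettiCohomology_map_abelJacobi_iff {k : Type} [Field k] [Algebra k ℂ]
    {C : SchemeOver k} (𝒥₁ 𝒥₂ : Jacobian C) (P : AlgPoints C k) (i : ℕ) :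
    IsIso (bettiCohomology.map (𝒥₁.abelJacobi P) i) ↔
      IsIso (bettiCohomology.map (𝒥₂.abelJacobi P) i) := by
  haveI : IsIso (𝒥₁.pushforward 𝒥₂ (𝟙 C)) := by
    rw [pushforward_id_eq_uniqueUpToIso_hom]
    infer_instance
  haveI := AbelianVariety.isIso_hom_hom_hom (𝒥₁.pushforward 𝒥₂ (𝟙 C))
  haveI := bettiCohomology.isIso_map (𝒥₁.pushforward 𝒥₂ (𝟙 C)).hom.hom.hom i
  rw [← bettiCohomology_map_pushforward_id_comp 𝒥₁ 𝒥₂ P i]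
  refine ⟨fun _ ↦ inferInstance, fun h ↦ ?_⟩
  exact IsIso.of_isIso_comp_left (bettiCohomology.map (𝒥₁.pushforward 𝒥₂ (𝟙 C)).hom.hom.hom i) _

/-- The comparison map for the chosen Jacobian `jacobian C h` is an isomorphism as soon as it is
for some Jacobian `𝒥` of `C` (independence of the model, `isIso_bettiCohomology_map_abelJacobi_iff`;
Milne, Remark 6.5). [cite: Milne1986JacobianVarieties, §6 Remark 6.5] -/
theorem isIso_bettiCohomology_map_abelJacobi_jacobian {k : Type} [Field k] [Algebra k ℂ]
    {C : SchemeOver k} (𝒥 : Jacobian C) (P : AlgPoints C k) (i : ℕ)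
    [IsIso (bettiCohomology.map (𝒥.abelJacobi P) i)] (h : Nonempty (Jacobian C)) :
    IsIso (bettiCohomology.map ((jacobian C h).abelJacobi P) i) :=
  (isIso_bettiCohomology_map_abelJacobi_iff 𝒥 (jacobian C h) P i).1 inferInstance

end Jacobian

end Literature.AlgebraicGeometry.Motives

end
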